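import Mathlib
import HarnessLib
import Summits.HubbardSuperconductivity.HubbardSuperconductivity.Theorems.KLProgrammeKLRegimeSplitTwoLegMultiSlot
import Summits.HubbardSuperconductivity.HubbardSuperconductivity.Theorems.KLProgrammeKLRegimeSplitTwoLegAngular
import Summits.HubbardSuperconductivity.HubbardSuperconductivity.Theorems.KLProgrammeKLRegimeSplitSymInterp

/-!
# Route `KLProgramme`, crux K3 — the (R-I) CORE of the Δ23 repair (plan g11 ruling 2026-08-27T00:30:14Z: «(R-I) adopted in principle; GO on the
# core module»; seat p2 g6): DE-INTERPOLATED FRAMES.  Frames and two-leg pieces as smooth `D₄`-symmetric `2π`-periodic FUNCTIONS; the model reads them through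
# `toTrigPoly L K := symInterp L (K ∘ latticeMomentum L)` (same lattice values); `klFrameExtFn` has NO interpolation.

Why (HOME/p2-g6/DELTA-INTERP.md, evidence #17 on 19823; p1 g7 00:13:42Z «NO ROUTE; (R-I)»): the second interpolation `klFrameExtG = symInterp L (…)`
has no L-uniform sup-Fréchet certificate at the top certified order (Kharshiladze–Lozinski), so (E3a-G) tier 2 / (E3a-MS) j = 3,4 / FrameOK (ii)
j = 3,4 cannot close through it.  With the objects below the C⁴ loop closes by chain rule + the cell's two-tier/multi-slot bookkeeping; no
interpolation theorem is needed anywhere in a derivative clause; (I-1) (`symInterp` of the LATTICE self-energy inside `klLocalPartFn`) is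
kept — its coefficients are the position-space kernel, its sup-derivatives are kernel moments (the engine's natural output).

What changes token-wise for every two-leg / frame text: `K : TrigPolyC4v ↦ K : (Fin 2 → ℝ) → ℝ`, `K.eval p ↦ K p`, `evalM X ↦ X ∘ WithLp.ofLp`
(written `onM X`), `fsub A B ↦ A - B` (pointwise), and every MODEL slot (`nambuXiCT`, `klLocSelfEnergyRe`, `klLegKernel`, `hubbardCovAboveCT`, …)
receives `toTrigPoly L K`.  Engine / split slot TEXTS are untouched (adapter at the bundle: `fun … K n => EngineBoundsAtV8S … (toTrigPoly L K) n`).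

Contents: §1 carrier predicate `IsSymmetricFrame`, `toTrigPoly`, the VALUE BRIDGE `eval_toTrigPoly_latticeMomentum` / `nambuXiCT_toTrigPoly`;
§2 `frameLevelFn`, `klFermiPointFn`, `klLocalPartFn`, the centred representative `centredRep`, `klFlatCutoffFn`, `klFrameExtFn` (a FUNCTION),
`klTwoLegPolyFn`, `klFrameProjFn`, `klTwoLegPieceFn` + telescoping; §3 `frameDistFn`, `FrameOKFn` (with an explicit `ContDiff ℝ 4` clause),
`RenormalisedAtFn`; §4 the two-leg clause texts `TwoLegSizesFn` / `TwoLegSizesMSFn` / `TwoLegFloorFn` / `FrameLipschitzFn` / `TwoLegSlopesFn` /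
`TwoLegAngularFn` / `TwoLegVolumeRateFn` / `TwoLegStepFn` (shapes = BundleV6 §3 + TwoLegMultiSlot + TwoLegAngular + BundleV7 (E3f), carrier swapped).
The same module serves (R-I-min) (frames stay `TrigPolyC4v` and enter as `K.eval`, `isSymmetricFrame_eval`).  NOT here (successor planner's
gates): `PredsFn`/GenericV5, histV13/klPredsV13, BundleV13.  Definitions + bridge/boundedness lemmas only; nothing is asserted about the model.
-/

noncomputable section

namespace Summit.HubbardSuperconductivity.HubbardSuperconductivity.Theorems.KLRegimeSplit

set_option linter.dupNamespace false -- summit = problem name (single-conjunct summit), D-0017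

open scoped InnerProductSpace
open Real Finset Literature.MathematicalPhysics.QuantumLattice Literature.Probability.LatticeModels
open Literature.MathematicalPhysics.QuantumLattice.FermiRG
open Summit.HubbardSuperconductivity.HubbardSuperconductivity.Theorems.KLProgrammeLegKernels
open Summit.HubbardSuperconductivity.HubbardSuperconductivity.Theorems.DispersionFlow
open Summit.HubbardSuperconductivity.HubbardSuperconductivity.Theorems.PerturbedFermiCurve

/-- A frame as a FUNCTION on continuum momenta. -/
abbrev FrameFn : Type := (Fin 2 → ℝ) → ℝ

/-! ## §1 Symmetric frames and the bridge to the model's `TrigPolyC4v` slots -/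

/-- **Symmetric frames**: `2π`-periodic in each coordinate, invariant under the axis reflection `(p₀,p₁) ↦ (p₀,−p₁)` and the swap
`(p₀,p₁) ↦ (p₁,p₀)` (hence under all of `D₄`).  Every `TrigPolyC4v` is one (`TrigPolyC4v.eval_periodic/_reflect`, `harmonic_swap`). -/
def IsSymmetricFrame (K : FrameFn) : Prop :=
  (∀ (p : Fin 2 → ℝ) (z : Fin 2 → ℤ), K (fun i => p i + z i * (2 * π)) = K p) ∧
    (∀ p : Fin 2 → ℝ, K ![p 0, -p 1] = K p) ∧ (∀ p : Fin 2 → ℝ, K ![p 1, p 0] = K p)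

/-- A `TrigPolyC4v` read as a function is a symmetric frame. -/
theorem isSymmetricFrame_eval (K : TrigPolyC4v) : IsSymmetricFrame K.eval :=
  ⟨TrigPolyC4v.eval_periodic K, TrigPolyC4v.eval_reflect K, fun p => by
    have h := TrigPolyC4v.harmonic_swap
    simp only [TrigPolyC4v.eval_def, h]⟩

/-- Symmetric frames are even: `K(−p) = K(p)` (reflection ∘ swap ∘ reflection ∘ swap). -/
theorem IsSymmetricFrame.neg {K : FrameFn} (hK : IsSymmetricFrame K) (p : Fin 2 → ℝ) : K (-p) = K p := by
  have h1 := hK.2.1 ![-p 0, p 1]      -- K ![-p 0, -p 1] = K ![-p 0, p 1]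
  have h2 := hK.2.2 ![p 1, -p 0]      -- K ![-p 0, p 1] = K ![p 1, -p 0]
  have h3 := hK.2.1 ![p 1, p 0]       -- K ![p 1, -p 0] = K ![p 1, p 0]
  have h4 := hK.2.2 p                 -- K ![p 1, p 0] = K p
  have hp : (-p) = ![-p 0, -p 1] := by funext i; fin_cases i <;> rfl
  simp only [Matrix.cons_val_zero, Matrix.cons_val_one] at h1 h2 h3
  rw [hp, h1, h2, h3, h4]

section Bridge

variable (L : ℕ) [NeZero L]

/-- **The model's view of a frame**: the `C₄ᵥ`-symmetrised trigonometric interpolant of its LATTICE VALUES.  Every model slot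
(`nambuXiCT`, `klLocSelfEnergyRe`, `hubbardCovAboveCT`, …) reads a frame only at lattice momenta, so it receives `toTrigPoly L K`. -/
def toTrigPoly (K : FrameFn) : TrigPolyC4v := symInterp L fun k => K (latticeMomentum L k)

/-- The lattice momentum of `−k` is minus that of `k` up to a period: `p(−k)_i = −p(k)_i + z_i·2π`, `z_i ∈ {0,1}`. -/
theorem latticeMomentum_neg_eq (k : TorusSite 2 L) :
    ∃ z : Fin 2 → ℤ, ∀ i, latticeMomentum L (-k) i = -latticeMomentum L k i + z i * (2 * π) := by
  refine ⟨fun i => if k i = 0 then 0 else 1, fun i => ?_⟩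
  simp only [latticeMomentum, Pi.neg_apply, ZMod.neg_val]
  have hL : (L : ℝ) ≠ 0 := by exact_mod_cast NeZero.ne L
  split_ifs with h
  · rw [h, ZMod.val_zero]; simp
  · rw [Nat.cast_sub (ZMod.val_lt _).le]
    push_cast
    field_simp
    ring

/-- One coordinate negated: `p(![k₀, −k₁]) = ![p(k)₀, −p(k)₁ + z·2π]`. -/
theorem latticeMomentum_reflect_eq (k : TorusSite 2 L) :
    ∃ z : ℤ, latticeMomentum L (![k 0, -k 1] : TorusSite 2 L) =
      fun i => (![latticeMomentum L k 0, -latticeMomentum L k 1] : Fin 2 → ℝ) i + (![(0 : ℤ), z] : Fin 2 → ℤ) i * (2 * π) := by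
  obtain ⟨z, hz⟩ := latticeMomentum_neg_eq L k
  refine ⟨z 1, funext fun i => ?_⟩
  fin_cases i
  · simp [latticeMomentum]
  · have h := hz 1
    simp only [latticeMomentum, Pi.neg_apply] at h ⊢
    simp only [Fin.mk_one, Matrix.cons_val_one, Matrix.cons_val_fin_one]
    rw [h]

/-- **THE VALUE BRIDGE**: at lattice momenta the model's view agrees with the frame, `(toTrigPoly L K).eval (p_q) = K (p_q)`. -/
theorem eval_toTrigPoly_latticeMomentum {K : FrameFn} (hK : IsSymmetricFrame K) (q : TorusSite 2 L) :
    (toTrigPoly L K).eval (latticeMomentum L q) = K (latticeMomentum L q) := by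
  unfold toTrigPoly
  refine symInterp_eval_latticeMomentum _ (fun k => ?_) (fun k => ?_) (fun k => ?_) q
  · obtain ⟨z, hz⟩ := latticeMomentum_neg_eq L k
    have h : latticeMomentum L (-k) = fun i => (-latticeMomentum L k) i + z i * (2 * π) := funext fun i => by rw [hz i]; rfl
    rw [h, hK.1, hK.neg]
  · obtain ⟨z, hz⟩ := latticeMomentum_reflect_eq L k
    rw [hz, hK.1, hK.2.1]
  · have h : latticeMomentum L (![k 1, k 0] : TorusSite 2 L) = ![latticeMomentum L k 1, latticeMomentum L k 0] := by
      funext i; fin_cases i <;> simp [latticeMomentum]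
    rw [h, hK.2.2]

/-- **The model's renormalised band at a symmetric frame reads the frame's values**: `e_K(k) = ε_L(k) − μ − K(p_k)`. -/
theorem nambuXiCT_toTrigPoly {K : FrameFn} (hK : IsSymmetricFrame K) (μ : ℝ) (k : TorusSite 2 L) :
    nambuXiCT L μ (toTrigPoly L K) k = torusBand L k - μ - K (latticeMomentum L k) := by
  rw [nambuXiCT, eval_toTrigPoly_latticeMomentum L hK]

end Bridge

/-! ## §2 The geometric objects of a frame and the de-interpolated two-leg objects -/

/-- A function on `Fin 2 → ℝ` read on `Momentum` (replaces `evalM`). -/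
def onM (X : FrameFn) : Momentum → ℝ := fun q => X (WithLp.ofLp q)

/-- **The renormalised band on `Momentum`**: `e_K = ε − μ − K` (replaces `frameLevel μ K`). -/
def frameLevelFn (μ : ℝ) (K : FrameFn) : Momentum → ℝ := fun q => squareDispersion 1 0 q - μ - K (WithLp.ofLp q)

/-- **The frame's Fermi point on the ray `θ`** (replaces `klFermiPoint`). -/
def klFermiPointFn (μ : ℝ) (K : FrameFn) (θ : ℝ) : Fin 2 → ℝ := perturbedFermiRadius (fun p => -K p) μ θ • dir θ

section Model

variable (L M : ℕ) [NeZero L] [NeZero M]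

/-- **The local part `ν_n(K)(θ)`** — (I-1) KEPT: the interpolant of the LATTICE self-energy of the action with frame `toTrigPoly L K`,
read at the frame's own Fermi point (replaces `klLocalPart`). -/
def klLocalPartFn (β U μ : ℝ) (K : FrameFn) (n : ℕ) (θ : ℝ) : ℝ :=
  (symInterp L (klLocSelfEnergyRe L M β U μ (toTrigPoly L K) n)).eval (klFermiPointFn μ K θ)

end Model

/-- The centred representative `p̃ ∈ [−π, π)²` of a continuum momentum (coordinatewise `toIocMod`; = `torusCentredMomentum` on the lattice). -/
def centredRep (p : Fin 2 → ℝ) : Fin 2 → ℝ := fun i => toIocMod Real.two_pi_pos (-π) (p i)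

/-- The free band on continuum momenta, `ε(p) = −2(cos p₀ + cos p₁)` (= `torusBand` on the lattice, `squareDispersion 1 0` on `Momentum`). -/
def freeBandFn (p : Fin 2 → ℝ) : ℝ := -2 * (Real.cos (p 0) + Real.cos (p 1))

/-- **The flat tube cutoff on continuum momenta**: `1 − χ₂((ε(p) − μ)²/(4·klFlatR²))` (= `klFlatCutoff L μ k` at `p = p_k`). -/
def klFlatCutoffFn (μ : ℝ) (p : Fin 2 → ℝ) : ℝ := 1 - salmhoferCutoff ((freeBandFn p - μ) ^ 2 / (4 * klFlatR ^ 2))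

/-- **The G-extension of an angular function, DE-INTERPOLATED**: the FUNCTION `p ↦ mean f + χ_flat(p)·(f(angle p̃) − mean f)` — constant
part untouched, mean-free part flat along rays inside the tube `|ε − μ| < 1/10` and zero outside (replaces `klFrameExtG L μ f = symInterp L (…)`).
For `μ ∈ klWindowC` the cutoff vanishes near `p̃ = 0` and near the boundary of the centred cell, so this is as smooth as `f`. -/
def klFrameExtFn (μ : ℝ) (f : ℝ → ℝ) : FrameFn :=
  fun p => klAngularMean f + klFlatCutoffFn μ p * (f (polarAngle (centredRep p)) - klAngularMean f)

section Model

variable (L M : ℕ) [NeZero L] [NeZero M]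

/-- **`D_n(K)`, de-interpolated**: the G-extension of the scale-`n` local part (replaces `klTwoLegPolyG`). -/
def klTwoLegPolyFn (β U μ : ℝ) (K : FrameFn) (n : ℕ) : FrameFn := klFrameExtFn μ (klLocalPartFn L M β U μ K n)

end Model

/-- **The normal form `P(K)`, de-interpolated**: the G-extension of `K` read on its own curve (replaces `klFrameProjG`). -/
def klFrameProjFn (μ : ℝ) (K : FrameFn) : FrameFn := klFrameExtFn μ fun θ => K (klFermiPointFn μ K θ)

section Model

variable (L M : ℕ) [NeZero L] [NeZero M]

/-- **The scale-`n` two-leg PIECE `ℓ_n(K)`, de-interpolated**: `D_0(K) − P(K)` at `n = 0`, `D_n(K) − D_{n-1}(K)` for `n ≥ 1`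
(pointwise differences; replaces `klTwoLegPieceG`). -/
def klTwoLegPieceFn (β U μ : ℝ) (K : FrameFn) (n : ℕ) : FrameFn :=
  if n = 0 then klTwoLegPolyFn L M β U μ K 0 - klFrameProjFn μ K
  else klTwoLegPolyFn L M β U μ K n - klTwoLegPolyFn L M β U μ K (n - 1)

/-- The piece at scale `0`. -/
theorem klTwoLegPieceFn_zero (β U μ : ℝ) (K : FrameFn) :
    klTwoLegPieceFn L M β U μ K 0 = klTwoLegPolyFn L M β U μ K 0 - klFrameProjFn μ K := by
  simp [klTwoLegPieceFn]

/-- The piece at scale `n + 1`. -/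
theorem klTwoLegPieceFn_succ (β U μ : ℝ) (K : FrameFn) (n : ℕ) :
    klTwoLegPieceFn L M β U μ K (n + 1) = klTwoLegPolyFn L M β U μ K (n + 1) - klTwoLegPolyFn L M β U μ K n := by
  simp [klTwoLegPieceFn]

/-- **Telescoping**: `Σ_{n ≤ N} ℓ_n(K) = D_N(K) − P(K)` (as functions). -/
theorem sum_klTwoLegPieceFn (β U μ : ℝ) (K : FrameFn) (N : ℕ) :
    ∑ n ∈ range (N + 1), klTwoLegPieceFn L M β U μ K n = klTwoLegPolyFn L M β U μ K N - klFrameProjFn μ K := by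
  induction N with
  | zero => simp [klTwoLegPieceFn_zero]
  | succ N ih => rw [sum_range_succ, ih, klTwoLegPieceFn_succ]; abel

end Model

/-! ## §3 Distance, the admissible class, the renormalisation predicate -/

/-- **The uniform distance of two frames**: `sup_p |K(p) − K′(p)|` (replaces `frameDist`). -/
def frameDistFn (K K' : FrameFn) : ℝ := ⨆ p : Fin 2 → ℝ, |K p - K' p|

/-- Every coordinate of the centred representative lies in `[−π, π]`. -/
theorem centredRep_mem_Icc (p : Fin 2 → ℝ) (i : Fin 2) : centredRep p i ∈ Set.Icc (-π) π := by
  have h := toIocMod_mem_Ioc Real.two_pi_pos (-π) (p i)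
  have h2 : -π + 2 * π = π := by ring
  rw [h2] at h
  exact Set.Ioc_subset_Icc_self h

/-- A symmetric frame takes the same value at a momentum and at its centred representative (periodicity). -/
theorem IsSymmetricFrame.apply_centredRep {K : FrameFn} (hK : IsSymmetricFrame K) (p : Fin 2 → ℝ) : K (centredRep p) = K p := by
  have hp : p = fun i => centredRep p i + (toIocDiv Real.two_pi_pos (-π) (p i) : ℤ) * (2 * π) := by
    funext i
    have h := (toIocMod_add_toIocDiv_zsmul Real.two_pi_pos (-π) (p i))
    simp only [centredRep, zsmul_eq_mul] at h ⊢
    linarith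
  conv_rhs => rw [hp]
  rw [hK.1]

/-- **A continuous symmetric frame is bounded** (continuous image of the compact cell `[−π, π]²`, then periodicity). -/
theorem IsSymmetricFrame.exists_bound {K : FrameFn} (hK : IsSymmetricFrame K) (hc : Continuous K) : ∃ B : ℝ, ∀ p, |K p| ≤ B := by
  have hcpt : IsCompact (Set.pi Set.univ fun _ : Fin 2 => Set.Icc (-π) π) := isCompact_univ_pi fun _ => isCompact_Icc
  obtain ⟨B, hB⟩ := hcpt.exists_bound_of_continuousOn hc.continuousOn
  refine ⟨B, fun p => ?_⟩
  rw [← hK.apply_centredRep p, ← Real.norm_eq_abs]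
  exact hB _ (fun i _ => centredRep_mem_Icc p i)

/-- For two continuous symmetric frames the pointwise distances are bounded above (so `frameDistFn` is a genuine supremum). -/
theorem bddAbove_range_abs_sub {K K' : FrameFn} (hK : IsSymmetricFrame K) (hc : Continuous K) (hK' : IsSymmetricFrame K')
    (hc' : Continuous K') : BddAbove (Set.range fun p : Fin 2 → ℝ => |K p - K' p|) := by
  obtain ⟨B, hB⟩ := hK.exists_bound hc
  obtain ⟨B', hB'⟩ := hK'.exists_bound hc'
  refine ⟨B + B', ?_⟩
  rintro _ ⟨p, rfl⟩
  calc |K p - K' p| ≤ |K p| + |K' p| := abs_sub _ _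
    _ ≤ B + B' := add_le_add (hB p) (hB' p)

/-- Pointwise distance ≤ `frameDistFn` (given boundedness, e.g. `bddAbove_range_abs_sub`). -/
theorem abs_sub_le_frameDistFn {K K' : FrameFn} (hbdd : BddAbove (Set.range fun p : Fin 2 → ℝ => |K p - K' p|))
    (p : Fin 2 → ℝ) : |K p - K' p| ≤ frameDistFn K K' :=
  le_ciSup hbdd p

/-- A uniform pointwise bound bounds `frameDistFn`. -/
theorem frameDistFn_le_of_forall {K K' : FrameFn} {B : ℝ} (h : ∀ p : Fin 2 → ℝ, |K p - K' p| ≤ B) : frameDistFn K K' ≤ B :=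
  ciSup_le h

/-- `frameDistFn` is nonnegative. -/
theorem frameDistFn_nonneg (K K' : FrameFn) : 0 ≤ frameDistFn K K' :=
  Real.iSup_nonneg fun _ => abs_nonneg _

/-- **`FrameOKFn R U N μ K`** — the admissible class, de-interpolated: (o) `K` is a symmetric frame; (i) FST II geometric constants of
`e_K` on `Momentum`, `GeomConstants (frameLevelFn μ K) 7 (3/80) (1/2) (3/200)`; (ii) `K = Σ_{n ≤ N} Kp n` with each piece a symmetric frame,
`C⁴` on `Momentum`, and `‖Dʲ(Kp n)‖ ≤ Gfr j · uPow j U · 4^{(j−2)n}` for `j ≤ 4` (the `ContDiff` clause is what makes the bounds meaningful for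
functions; for `TrigPolyC4v` it was automatic). -/
def FrameOKFn (R : RenConsts) (U : ℝ) (N : ℕ) (μ : ℝ) (K : FrameFn) : Prop :=
  IsSymmetricFrame K ∧ GeomConstants (frameLevelFn μ K) 7 (3 / 80) (1 / 2) (3 / 200) ∧
  ∃ Kp : ℕ → FrameFn,
    (∀ p : Fin 2 → ℝ, K p = ∑ n ∈ range (N + 1), Kp n p) ∧
    ∀ n ≤ N, IsSymmetricFrame (Kp n) ∧ ContDiff ℝ 4 (onM (Kp n)) ∧
      ∀ j ≤ 4, ∀ q : Momentum, ‖iteratedFDeriv ℝ j (onM (Kp n)) q‖ ≤ R.Gfr j * uPow j U * (4 : ℝ) ^ (((j : ℤ) - 2) * n)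

/-- An admissible frame is a symmetric frame. -/
theorem FrameOKFn.isSymmetricFrame {R : RenConsts} {U : ℝ} {N : ℕ} {μ : ℝ} {K : FrameFn} (h : FrameOKFn R U N μ K) :
    IsSymmetricFrame K := h.1

/-- An admissible frame has the FST II geometric constants. -/
theorem FrameOKFn.geom {R : RenConsts} {U : ℝ} {N : ℕ} {μ : ℝ} {K : FrameFn} (h : FrameOKFn R U N μ K) :
    GeomConstants (frameLevelFn μ K) 7 (3 / 80) (1 / 2) (3 / 200) := h.2.1

/-- **An admissible frame is `C⁴` on `Momentum`** (finite sum of `C⁴` pieces; note x3 of plan g11's XREAD). -/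
theorem FrameOKFn.contDiff {R : RenConsts} {U : ℝ} {N : ℕ} {μ : ℝ} {K : FrameFn} (h : FrameOKFn R U N μ K) :
    ContDiff ℝ 4 (onM K) := by
  obtain ⟨Kp, hsum, hp⟩ := h.2.2
  have hfun : onM K = fun q : Momentum => ∑ n ∈ range (N + 1), onM (Kp n) q := by
    funext q; simp only [onM, hsum]
  rw [hfun]
  exact ContDiff.sum fun n hn => (hp n (Nat.lt_succ_iff.mp (mem_range.mp hn))).2.1

/-- An admissible frame is continuous (as a function on `Fin 2 → ℝ`). -/
theorem FrameOKFn.continuous {R : RenConsts} {U : ℝ} {N : ℕ} {μ : ℝ} {K : FrameFn} (h : FrameOKFn R U N μ K) :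
    Continuous K := by
  have hc : Continuous (onM K) := h.contDiff.continuous
  have hK : K = fun p : Fin 2 → ℝ => onM K (WithLp.toLp 2 p) := by funext p; simp [onM]
  rw [hK]
  exact hc.comp (PiLp.continuous_toLp 2 _)

section Model

variable (L M : ℕ) [NeZero L] [NeZero M]

/-- **`RenormalisedAtFn … K R n`**: `|ν_n(K)(θ)| ≤ cr·|U|·Λ_n²/e₀` for every angle (replaces `RenormalisedAtF`; same text). -/
def RenormalisedAtFn (β U μ : ℝ) (K : FrameFn) (R : RenConsts) (n : ℕ) : Prop :=
  ∀ θ : ℝ, |klLocalPartFn L M β U μ K n θ| ≤ R.cr * |U| * klScale klE0 n ^ 2 / klE0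

/-! ## §4 The two-leg clause texts on the function carrier -/

/-- **(E3a-Fn)** sizes of the scale-`n` piece, two-tier, with the smoothness clause explicit. -/
def TwoLegSizesFn (G : GeoConsts) (Q : EngConsts) (R : RenConsts) (β U μ : ℝ) (K : FrameFn) (n : ℕ) : Prop :=
  ContDiff ℝ 4 (onM (klTwoLegPieceFn L M β U μ K n)) ∧
  (∀ j ≤ 2, ∀ q : Momentum, ‖iteratedFDeriv ℝ j (onM (klTwoLegPieceFn L M β U μ K n)) q‖ ≤ twoLegBar G Q U j n) ∧
  (FrameOKFn R U n μ K → ∀ j ≤ 4, ∀ q : Momentum,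
      ‖iteratedFDeriv ℝ j (onM (klTwoLegPieceFn L M β U μ K n)) q‖ ≤ twoLegBar G Q U j n)

/-- **(E3a-MS-Fn)** multi-slot sizes: `ℓ_n(K) = lp n + Σ_{m ∈ Ioc n (nScales β)} lp m` with symmetric `C⁴` slot functions within the
slot allowances (replaces `TwoLegSizesMS`; same numerals `msBar`). -/
def TwoLegSizesMSFn (G : GeoConsts) (Q : EngConsts) (R : RenConsts) (β U μ : ℝ) (K : FrameFn) (n : ℕ) : Prop :=
  ∃ lp : ℕ → FrameFn,
    (∀ p : Fin 2 → ℝ, klTwoLegPieceFn L M β U μ K n p = lp n p + ∑ m ∈ Ioc n (nScales β), lp m p) ∧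
    (∀ m, IsSymmetricFrame (lp m) ∧ ContDiff ℝ 4 (onM (lp m))) ∧
    (∀ j ≤ 4, ∀ q : Momentum, ‖iteratedFDeriv ℝ j (onM (lp n)) q‖ ≤ twoLegBar G Q U j n) ∧
    (∀ m ∈ Ioc n (nScales β), ∀ j ≤ 4, ∀ q : Momentum,
        ‖iteratedFDeriv ℝ j (onM (lp m)) q‖ ≤ msBar G Q U n * (R.Gfr j * uPow j U * (4 : ℝ) ^ (((j : ℤ) - 2) * m)))

/-- **(E3b-Fn)** the per-scale tangential floor of the piece along the level sets of `e_K` inside the tube. -/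
def TwoLegFloorFn (G : GeoConsts) (Q : EngConsts) (β U μ : ℝ) (K : FrameFn) (n : ℕ) : Prop :=
  ∀ p : Momentum, |frameLevelFn μ K p| < 3 / 80 → ∀ t : Momentum,
    inner ℝ (gradient (frameLevelFn μ K) p) t = 0 →
      -(bflBar G Q U n) * ‖t‖ ^ 2 ≤ hessQuad (onM (klTwoLegPieceFn L M β U μ K n)) p t

/-- **(E3c-Fn)** the frame-Lipschitz bound of the piece with abstracted history (replaces `FrameLipschitzG`). -/
def FrameLipschitzFn (hist : FrameFn → ℕ → Prop) (G : GeoConsts) (Q : EngConsts) (R : RenConsts) (β U μ : ℝ)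
    (K : FrameFn) (n : ℕ) : Prop :=
  ∀ K' : FrameFn, FrameOKFn R U (klTempScaleIdx β klE0) μ K' → (∀ j < n, hist K' j) →
    ∀ q : Fin 2 → ℝ,
      |klTwoLegPieceFn L M β U μ K n q - klTwoLegPieceFn L M β U μ K' n q| ≤ lipBar G Q U n * frameDistFn K K'

/-- **(E3d/e-Fn)** field strength and normal slope on the scale-`n` shell of the model's band `nambuXiCT L μ (toTrigPoly L K)`
(replaces `TwoLegSlopes`; the model objects receive `toTrigPoly L K`). -/
def TwoLegSlopesFn (R : RenConsts) (β U μ : ℝ) (K : FrameFn) (n : ℕ) : Prop :=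
  ∀ k ∈ klShell L μ (toTrigPoly L K) n,
    |klFieldStrength L M β U μ (toTrigPoly L K) n k - 1| ≤ R.cz * |U| ∧
      |klLocSelfEnergyRe L M β U μ (toTrigPoly L K) n k - klLocalPartFn L M β U μ K n (momentumAngle L k)| ≤
        R.cz * |U| * |nambuXiCT L μ (toTrigPoly L K) k|

/-- **(E3g-Fn)** angular regularity of the local part (replaces `TwoLegAngularG`; same majorant `angBar`). -/
def TwoLegAngularFn (G : GeoConsts) (Q : EngConsts) (R : RenConsts) (β U μ : ℝ) (K : FrameFn) (n : ℕ) : Prop :=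
  ContDiff ℝ 4 (klLocalPartFn L M β U μ K n) ∧
    ∀ j : ℕ, 1 ≤ j → j ≤ 4 → ∀ θ : ℝ, |iteratedDeriv j (klLocalPartFn L M β U μ K n) θ| ≤ angBar G Q R U (nScales β) j

/-- **(E3f-Fn)** the finite-volume rate of the local part between `(L, M)` and larger volumes carrying the history (replaces `TwoLegVolumeRate`). -/
def TwoLegVolumeRateFn (hist : (L' M' : ℕ) → [NeZero L'] → [NeZero M'] → FrameFn → ℕ → Prop) (Q : EngConsts) (β U μ : ℝ)
    (K : FrameFn) (n : ℕ) : Prop :=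
  Q.M0 β L ≤ M → ∀ (L' M' : ℕ) [NeZero L'] [NeZero M'], L ≤ L' → Q.M0 β L' ≤ M' →
    (∀ j < n, hist L' M' K j) →
      ∀ θ : ℝ, |klLocalPartFn L M β U μ K n θ - klLocalPartFn L' M' β U μ K n θ| ≤ Q.CL β n / L

/-- **`TwoLegStepFn hist …`** := (E3a-Fn) ∧ (E3b-Fn) ∧ (E3c-Fn) ∧ (E3d/e-Fn) (the shape of `TwoLegStepG`, carrier swapped). -/
def TwoLegStepFn (hist : FrameFn → ℕ → Prop) (G : GeoConsts) (_P : SplitConsts) (Q : EngConsts) (R : RenConsts)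
    (β U μ : ℝ) (K : FrameFn) (n : ℕ) : Prop :=
  TwoLegSizesFn L M G Q R β U μ K n ∧ TwoLegFloorFn L M G Q β U μ K n ∧
    FrameLipschitzFn L M hist G Q R β U μ K n ∧ TwoLegSlopesFn L M R β U μ K n

end Model

end Summit.HubbardSuperconductivity.HubbardSuperconductivity.Theorems.KLRegimeSplit

end
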